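import Summits.BirchSwinnertonDyer.Rank1Residual.ManinAdditive.ShimuraKernel
import HarnessLib
import HarnessLib.Audit.Tags

/-!
# Sketch-es-g38 — KUMMER–DIAMOND RECIPROCITY AT THE ATKIN–LEHNER CUSPS (cell `bsd-f2-manin`, seat `-es` g38, MEMO-es §59)

Typed rows (nothing asserted; candidate LAWS are `@[conjecture]` obligation nodes):

* **E-es-184 `DiamondCharacterConductorLaw`** (LEMMA M, support, provable): the diamond character
  `ϖ_f : (ℤ/N)ˣ → Λ₀(f)/Λ₁(f)`, `d(γ) ↦ {∞, γ∞}_f mod Λ₁(f)`, factors through `(ℤ/M)ˣ/±1`,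
  `M = ∏_{p^v ∥ N} p^{⌈v/2⌉}` (parabolic elements have zero period and their `d`-entries generate `{x ≡ 1 mod M}`).
* **E-es-185 `IndexFourForcesFreyTwistShape`** (THEOREM K ⟹ …, paper; candidate LAW): in the index-4 world
  `Λ₁(f) = 2Λ₀(f)` of a lattice-optimal `X₀(N)`-datum, `2⁵ ∣ N` and `W₀ ≅ y² = x(x − 2s²)(x − t²)` with `s` even, `t` odd.
* **E-es-186 `FreyTwistShapeTwoAdicLaw`** (Tate's algorithm; j337520 PART B: 350/350 with `v₂(N) = 4`; candidate LAW):
  a curve of that shape has `¬ 2⁵ ∣ N`.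
* PROVED glue: E-es-185 ∧ E-es-186 ⟹ E-an-152b `ShimuraIndexNeFourAtFour` (indeed `Λ₁(f) ≠ 2Λ₀(f)` at every level),
  hence with CDT ⟹ C2 `ManinOddAtFour` (landed `CDivAssembly.maninOddAtFour_of_CDT_indexNeFour`; this composition is PROVED in the
  sibling `KummerDiamondShapeLawsSplit.lean` — import-cone split, see the typer note).

TYPER NOTE (typer g21, T-es-72).  SOURCE = HOME/es/g38/Sketch-es-g38.lean sha16 f640306077cb1c09 (120 l.; es: farm rc 0·0·0·0; BC7 3/3 CLEAN
Probe-es-g38.lean 176e0b6e6ed261c8; MEMO-es §59, pack HOME/es/g38/ + SHA16SUMS.es.g38) VERBATIM, SPLIT BY IMPORT CONE (HOME/typer/README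
gotcha 96/118): the sketch's one import `Theorems.ManinLocalTwoThreeCDivisionAssembly` is INSIDE the `Theses.ManinLocalTwoThree` cone (BFS
02:4xZ), so THIS LEAF keeps every def, the three rows and the cone-free glue (`periodLatticeGamma1_ne_two_mul`,
`shimuraIndexNeFourAtFour_of_shape_laws`, §4 sanity) on the route-independent import `…ManinAdditive.ShimuraKernel` (cone-free, 11-module
closure), and the ONE composition naming the route decl — `maninOddAtFour_of_CDT_shape_laws : CDT → 185 → 186 → Theses.ManinLocalTwoThree.ManinOddAtFour`
via `CDivAssembly.maninOddAtFour_of_CDT_indexNeFour` (p754408) — is PROVED verbatim in the sibling `KummerDiamondShapeLawsSplit.lean` (imports this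
leaf + `…CDivisionAssembly`, kind proof).  Other typer deltas: namespace `…ManinAdditive.EsG38` → `…ManinAdditive.KummerDiamond` (named for the
mathematics); one-line docstring added to `freyTwistCurve_a` (gate lint); cite keys unchanged (`Manin1972`, `Stevens1989`, `LingOesterle1991`,
`DiamondKramer1995` — all in references.bib, the last an interim stub).  ROWS: E-es-184 `DiamondCharacterConductorLaw` (support, plain def),
**E-es-185 `IndexFourForcesFreyTwistShape`**, **E-es-186 `FreyTwistShapeTwoAdicLaw`** (`@[conjecture]`, nothing asserted); defs `ceilSqrtLevel`,
`freyTwistCurve`, `HasFreyTwistShape`.  REFUTER: ref1/ref2 R-es-87 PENDING at landing.  No instances, no notation, no sorry.  bears_on: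
stmt-BirchSwinnertonDyer-22967 (C2 `ManinOddAtFour` «⟸ CDT ∧ 185 ∧ 186», priced per the director's 00:56Z freeze «⟸ Stevens I (strong) via
E-an-242 / CDT»).  BSD is not proved by this; Manin c = 1 not proved; C2/C3 OPEN.
-/

set_option autoImplicit false

noncomputable section

open WeierstrassCurve Literature.NumberTheory.EllipticCurves Literature.NumberTheory.EllipticCurves.ModularForms
open CongruenceSubgroup
open scoped MatrixGroups
open Summit.BirchSwinnertonDyer.Rank1Residual.ManinAdditive.ShimuraKernel

namespace Summit.BirchSwinnertonDyer.Rank1Residual.ManinAdditive.KummerDiamond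

/-! ## §0 Shapes and the level radical -/

/-- `M(N) = ∏_{p^v ∥ N} p^{⌈v/2⌉}` — the conductor of the diamond character (LEMMA M). -/
def ceilSqrtLevel (N : ℕ) : ℕ :=
  N.factorization.prod fun p v => p ^ ((v + 1) / 2)

/-- The Frey-twist curve `y² = x(x − 2s²)(x − t²) = x³ − (2s² + t²)x² + 2s²t²·x`. -/
def freyTwistCurve (s t : ℤ) : WeierstrassCurve ℚ :=
  { a₁ := 0, a₂ := -((2 * s ^ 2 + t ^ 2 : ℤ) : ℚ), a₃ := 0, a₄ := ((2 * s ^ 2 * t ^ 2 : ℤ) : ℚ), a₆ := 0 }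

/-- `W` is `ℚ`-isomorphic to `y² = x(x − 2s²)(x − t²)` for some EVEN `s` and ODD `t`. -/
def HasFreyTwistShape (W : WeierstrassCurve ℚ) : Prop :=
  ∃ (s t : ℤ) (C : WeierstrassCurve.VariableChange ℚ), Even s ∧ Odd t ∧ C • W = freyTwistCurve s t

/-! ## §1 E-es-184 — LEMMA M (support) -/

/-- **E-es-184 `DiamondCharacterConductorLaw`** (LEMMA M; support, provable from `cuspSymbol_mul_holds`,
`cuspSymbol_mem_periodLatticeGamma1_of_apply_eq_one` and the vanishing of periods of parabolic elements):
for every `f ∈ S₂(Γ₀(N))` and `γ ∈ Γ₀(N)` whose lower-right entry is `≡ ±1 (mod M(N))`, `{∞, γ∞}_f ∈ Λ₁(f)`.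
[cite: Manin1972, Prop. 1.4 / Thm. 1.6 (the period homomorphism; parabolic classes are trivial in H₁(X₀(N), ℤ))] -/
def DiamondCharacterConductorLaw : Prop :=
  ∀ {N : ℕ} [NeZero N] (f : CuspForm (Gamma0 N) 2) (γ : Gamma0 N),
    ((((γ : SL(2, ℤ)) 1 1 : ℤ) : ZMod (ceilSqrtLevel N)) = 1 ∨
      (((γ : SL(2, ℤ)) 1 1 : ℤ) : ZMod (ceilSqrtLevel N)) = -1) →
    cuspSymbol f γ ∈ periodLatticeGamma1 f

/-! ## §2 E-es-185 / E-es-186 — the two candidate LAWS -/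

/-- **E-es-185 `IndexFourForcesFreyTwistShape`** (candidate LAW, nothing asserted; MEMO-es §59 THEOREM K + the Kummer-sign
exclusion).  In the index-4 world `Λ₁(f) = 2Λ₀(f)` of a lattice-optimal `X₀(N)`-datum: `2⁵ ∣ N` and the curve has the Frey-twist
shape `y² = x(x − 2s²)(x − t²)`, `s` even, `t` odd.  Mechanism: Kummer–diamond reciprocity `δ_θ(φ₀(w_Q∞)) = ϖ_Q ∘ χ_Q⁻¹` at every
Atkin–Lehner cusp (Stevens 1982 Thm. 1.3.1(b) for the Galois action on the fibre), LEMMA M, `ϖ(−1) = 0`, and the signs of the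
2-descent coordinates of the rational 2-torsion.  Why it might fail: a slip in the residual case (M1) `S = {2^a, p}`, `p ≡ 7 (8)`;
vacuously true if no index-4 class exists (expected).  [cite: Stevens1989, §2] [cite: LingOesterle1991, Thm. 6] -/
@[conjecture]
def IndexFourForcesFreyTwistShape : Prop :=
  ∀ (W₀ : WeierstrassCurve ℚ) [W₀.IsElliptic] [W₀.IsGloballyMinimal] {N : ℕ} [NeZero N]
    (D₀ : ModularParametrizationData W₀ N),
    (∀ z ∈ D₀.L.lattice, ∃ w ∈ periodLattice D₀.f, z = D₀.c * w) →
    (∀ z : ℂ, z ∈ periodLatticeGamma1 D₀.f ↔ ∃ w ∈ periodLattice D₀.f, z = 2 * w) →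
    2 ^ 5 ∣ N ∧ HasFreyTwistShape W₀

/-- **E-es-186 `FreyTwistShapeTwoAdicLaw`** (candidate LAW, nothing asserted; Tate's algorithm at `2`): an elliptic curve over `ℚ`
isomorphic to `y² = x(x − 2s²)(x − t²)` with `s` even and `t` odd has conductor exponent `≤ 4` at `2` (in fact `= 4`; it is the
`χ₋₄`-twist side of the Frey–Hellegouarch family), so no modular parametrisation datum of it lives at a level divisible by `2⁵`.
BC5: j337520 PART B, 350/350 pairs `(s,t)`, `v₂(s) ∈ {1,…,7}`, all with `v₂(N) = 4` (and `v₂(N) = 5` for all 76 odd `s`).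
Why it might fail: only through `IsNewformOf` not pinning `N` to the conductor (it does: `aₙ(f) = aₙ(W)`).
[cite: DiamondKramer1995, (conductor of Frey curves at 2; shape of the statement)] -/
@[conjecture]
def FreyTwistShapeTwoAdicLaw : Prop :=
  ∀ (W₀ : WeierstrassCurve ℚ) [W₀.IsElliptic] {N : ℕ} [NeZero N] (_D₀ : ModularParametrizationData W₀ N),
    HasFreyTwistShape W₀ → ¬ 2 ^ 5 ∣ N

/-! ## §3 PROVED glue -/

/-- E-es-185 ∧ E-es-186 ⟹ `Λ₁(f) ≠ 2Λ₀(f)` for EVERY lattice-optimal datum (no `4 ∣ N` needed). -/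
theorem periodLatticeGamma1_ne_two_mul (h185 : IndexFourForcesFreyTwistShape) (h186 : FreyTwistShapeTwoAdicLaw)
    (W₀ : WeierstrassCurve ℚ) [W₀.IsElliptic] [W₀.IsGloballyMinimal] {N : ℕ} [NeZero N]
    (D₀ : ModularParametrizationData W₀ N) (h₀ : ∀ z ∈ D₀.L.lattice, ∃ w ∈ periodLattice D₀.f, z = D₀.c * w) :
    ¬ (∀ z : ℂ, z ∈ periodLatticeGamma1 D₀.f ↔ ∃ w ∈ periodLattice D₀.f, z = 2 * w) := fun hidx =>
  h186 W₀ D₀ (h185 W₀ D₀ h₀ hidx).2 (h185 W₀ D₀ h₀ hidx).1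

/-- E-es-185 ∧ E-es-186 ⟹ E-an-152b `ShimuraIndexNeFourAtFour`. -/
theorem shimuraIndexNeFourAtFour_of_shape_laws (h185 : IndexFourForcesFreyTwistShape)
    (h186 : FreyTwistShapeTwoAdicLaw) : ShimuraIndexNeFourAtFour := by
  intro W₀ _ _ N _ D₀ h₀ _h4
  exact periodLatticeGamma1_ne_two_mul h185 h186 W₀ D₀ h₀

/-! ## §4 Sanity: the shape is elliptic-curve-shaped (discriminant) and has full rational 2-torsion -/

/-- The Frey-twist model has `a₁ = a₃ = a₆ = 0`. -/
theorem freyTwistCurve_a (s t : ℤ) :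
    (freyTwistCurve s t).a₁ = 0 ∧ (freyTwistCurve s t).a₃ = 0 ∧ (freyTwistCurve s t).a₆ = 0 := ⟨rfl, rfl, rfl⟩

/-- `x = 0`, `x = 2s²`, `x = t²` are roots of the 2-division cubic of the Frey-twist curve. -/
theorem freyTwistCurve_twoTorsion_roots (s t : ℤ) (x : ℚ) (hx : x = 0 ∨ x = 2 * s ^ 2 ∨ x = t ^ 2) :
    x ^ 3 + (freyTwistCurve s t).a₂ * x ^ 2 + (freyTwistCurve s t).a₄ * x + (freyTwistCurve s t).a₆ = 0 := by
  rcases hx with rfl | rfl | rfl <;> simp [freyTwistCurve] <;> ring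

end Summit.BirchSwinnertonDyer.Rank1Residual.ManinAdditive.KummerDiamond

end
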